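import Summits.ResolutionOfSingularities.ResolutionOfSingularities.Theorems.FrobeniusClosingPatchingRelPerfectDepthPhaseCLetterLaws
import Summits.ResolutionOfSingularities.ResolutionOfSingularities.Theorems.FrobeniusClosingPatchingRelPerfectDepthPhaseCCarrierRsop
import HarnessLib

/-!
# Crux `PatchingRelPerfect` (stmt-ResolutionOfSingularities-16161), chain W5.2 — F7(β) (β-AX) PHASE C, X3 C-II (tail lemma):
# the ONE-STEP CHART LAWS of the PURE-MEMBER TAIL CLASS `K = (g) + (g + U·M) + (N̄)`

[OURS · L1 W5.2 · F7(β) (β-AX) X3 `PhaseCTermination₂`, C-II tail lemma · res-L1-w52-plan-1 NAMING 16:52:03Z (object (B), spec verbatim) +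
CLARIFY 16:54:00Z (stub-1 first refusal) · res-L1-w52-idea-1 X3 memo inst. 2 P1 · res-L1-w52-tri-2 v11.8 `TAILTABLE.md` 8a752fef2fe0b799
(empirical law: strict tail length ≤ deg M + deg N̄ (+2) on 777 states)] res-L1-w52-stub-1 g5.  Replaces the role of NO printed item; NOT a
statement of the manuscript under review (AI-written, weaker than expert review).  Ring level, ANY commutative ring, ALL exponents symbolic.

The class (Lemma R: read near a point of the carrier `G = V(g)` of a bare host): `K = (g) + (g + U·M) + (N̄)` with `U` a unit and `M`, `N̄`
MONOMIALS in the member letters through the point.  S1-admissible centres = member coordinate strata `W = V(g, t_I)` inside `cosupp K`,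
i.e. `|α_I(M)| ≥ 1` and `|α_I(N̄)| ≥ 1`; weight `ν = 1` (Lemma R (R3)).  LAW (every chart `t_j`, `j ∈ I`): the new exceptional letter `t_j`
gets the exponent `|α_I(·)| − 1` in `M` and in `N̄`, ALL OTHER EXPONENTS ARE KEPT, `U ↦ U`; the `g`-chart is `(g)`.

* §1 three member letters `(t, u, v)`, exponents `(a, b, c | a′, b′, c′)`: `tail_strip_chart` (centre `V(g,t)`: `a ↦ a − 1`, `a′ ↦ a′ − 1`),
  `tail_curve_chart_t` / `tail_curve_chart_u` (centre `V(g,t,u)`: new exceptional exponent `a + b − 1` resp. `a′ + b′ − 1`),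
  `tail_point_chart` (centre `V(g,t,u,v)`: `a + b + c − 1` / `a′ + b′ + c′ − 1`), and the `g`-charts `tail_*_gchart` (`= (g)`);
* §2 the GENERAL law over `Fin k` letters and any centre `I ∋ j`: `prod_pow_chartSubst` (`∏ σᵢ^{aᵢ} = s_j^{Σ_I a} · ∏_{i ≠ j} sᵢ^{aᵢ}` for the
  chart substitution `σᵢ = s_j sᵢ` (`i ∈ I ∖ j`), `σᵢ = sᵢ` otherwise), `tail_chart_general`, `prod_pow_gSubst`, `tail_gchart_general`;
* §3 END leaves: `tail_weak` (`K = (g) + (M) + (N̄)` as ideals — WEAK END at every point), `tail_eq_top_of_isUnit` (`M` a unit ⇒ `K = ⊤`: the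
  point has left `cosupp`), the RESIDUAL-EMPTY leaves of RULING G11-25 A8 `tail_of_dvd_left` / `tail_of_dvd_right` (`M ∣ N̄` or `N̄ ∣ M` ⇒
  `K = (g) + (one monomial)`, i.e. `K̄♭ = ⊤` on the carrier), and the STRICT non-END reading `tail_not_isRsopPart`: if a member letter `t` through the point divides `M` then
  `(g, g + U·M, t)` is NOT part of a regular system of parameters (host₂ ∈ (g, t)); by `IsRsopPart.comp` no larger format family is either.
  Hence in this class: **STRICT END at a point of `cosupp K` ⟺ no member through the point divides `M` ⟺ `M` is a unit there**, while
  **RESIDUAL-EMPTY ⟸ `M ∣ N̄` or `N̄ ∣ M`** (comparability instead of triviality) — the difference is the local-principalization tail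
  (plan-1 17:00:47Z (2): tri-2's «+2»).

Fact-free; citation material for idea-1 (P1) / lead-1 (X3 typer) / the TailRuns.  Neighbours (imported, not re-declared): `…LetterLaws`
(`germ_factor`, `germ_eq`, `germ_eq_span_of_dvd`), `…UniaxialLaws`, `…ContactLaws`, `…CarrierRsop`.

## References
* The Stacks Project, Tags 0804, 0BIQ (affine blow-up algebras and their charts). [StacksProject]
* J. Kollár, *Lectures on Resolution of Singularities* (2007), (3.111) Step 3 (monomial bookkeeping). [Kollar2007]
* H. Matsumura, *Commutative Ring Theory* (1986), Thm. 14.2. [Matsumura1987]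
-/

-- `Summit.<Summit>.<Sub>.Theorems` with `Sub = Summit` (single-conjunct summit, D-0017)
set_option linter.dupNamespace false

noncomputable section

open Literature.AlgebraicGeometry.Resolution
open scoped BigOperators

namespace Summit.ResolutionOfSingularities.ResolutionOfSingularities.Theorems

universe u

namespace DepthPhaseC

/-- The letter-class germ `K = (g) + (g + φ) + (n)` (as in `…DepthPhaseCLetterLaws`). -/
local notation3 "Kl[" g "," φ "," n "]" => (Ideal.span {g} ⊔ Ideal.span {g + φ} ⊔ Ideal.span {n})

/-! ## §1 Three member letters `t, u, v` -/

section Three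

variable {A : Type u} [CommRing A]

/-- **Strip** (centre the divisor `V(g, t)` of the carrier; `a, a′ ≥ 1`), `t`-chart (`g = t g′`): `(a, a′) ↦ (a − 1, a′ − 1)`, the rest kept.
[folklore] -/
theorem tail_strip_chart (g' U t u v : A) (a b c a' b' c' : ℕ) :
    Kl[t * g', U * (t ^ (a + 1) * u ^ b * v ^ c), t ^ (a' + 1) * u ^ b' * v ^ c'] =
      Ideal.span {t} * Kl[g', U * (t ^ a * u ^ b * v ^ c), t ^ a' * u ^ b' * v ^ c'] := by
  rw [show U * (t ^ (a + 1) * u ^ b * v ^ c) = t * (U * (t ^ a * u ^ b * v ^ c)) by ring,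
    show t ^ (a' + 1) * u ^ b' * v ^ c' = t * (t ^ a' * u ^ b' * v ^ c') by ring, germ_factor]

/-- **Strip, `g`-chart** (`t = g t′`; `a, a′ ≥ 1`): the germ is `(g)`. [folklore] -/
theorem tail_strip_gchart (g U t' u v : A) (a b c a' b' c' : ℕ) :
    Kl[g, U * ((g * t') ^ (a + 1) * u ^ b * v ^ c), (g * t') ^ (a' + 1) * u ^ b' * v ^ c'] = Ideal.span {g} := by
  rw [show U * ((g * t') ^ (a + 1) * u ^ b * v ^ c) = g * (U * g ^ a * t' ^ (a + 1) * u ^ b * v ^ c) by ring,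
    show (g * t') ^ (a' + 1) * u ^ b' * v ^ c' = g * (g ^ a' * t' ^ (a' + 1) * u ^ b' * v ^ c') by ring, germ_eq_span_of_dvd]

/-- **Curve** (centre `V(g, t, u)`; `a + b ≥ 1`, `a′ + b′ ≥ 1`), `t`-chart (`g = t g′`, `u = t u′`): the new exceptional `t` carries
`a + b − 1` resp. `a′ + b′ − 1`; `u′` keeps `b`, `b′`; `v` keeps `c`, `c′`. [folklore] -/
theorem tail_curve_chart_t (g' U t u' v : A) {a b : ℕ} (c : ℕ) {a' b' : ℕ} (c' : ℕ) (hab : 1 ≤ a + b) (hab' : 1 ≤ a' + b') :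
    Kl[t * g', U * (t ^ a * (t * u') ^ b * v ^ c), t ^ a' * (t * u') ^ b' * v ^ c'] =
      Ideal.span {t} * Kl[g', U * (t ^ (a + b - 1) * u' ^ b * v ^ c), t ^ (a' + b' - 1) * u' ^ b' * v ^ c'] := by
  obtain ⟨k, hk⟩ := Nat.exists_eq_add_of_le hab
  obtain ⟨l, hl⟩ := Nat.exists_eq_add_of_le hab'
  rw [hk, hl, Nat.add_sub_cancel_left, Nat.add_sub_cancel_left,
    show U * (t ^ a * (t * u') ^ b * v ^ c) = t * (U * (t ^ k * u' ^ b * v ^ c)) by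
      rw [mul_pow, show U * (t ^ a * (t ^ b * u' ^ b) * v ^ c) = t ^ (a + b) * (U * (u' ^ b * v ^ c)) by ring, hk]; ring,
    show t ^ a' * (t * u') ^ b' * v ^ c' = t * (t ^ l * u' ^ b' * v ^ c') by
      rw [mul_pow, show t ^ a' * (t ^ b' * u' ^ b') * v ^ c' = t ^ (a' + b') * (u' ^ b' * v ^ c') by ring, hl]; ring,
    germ_factor]

/-- **Curve, `u`-chart** (`g = u g′`, `t = u t′`): the new exceptional `u` carries `a + b − 1` resp. `a′ + b′ − 1`; `t′` keeps `a`, `a′`.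
[folklore] -/
theorem tail_curve_chart_u (g' U t' u v : A) {a b : ℕ} (c : ℕ) {a' b' : ℕ} (c' : ℕ) (hab : 1 ≤ a + b) (hab' : 1 ≤ a' + b') :
    Kl[u * g', U * ((u * t') ^ a * u ^ b * v ^ c), (u * t') ^ a' * u ^ b' * v ^ c'] =
      Ideal.span {u} * Kl[g', U * (u ^ (a + b - 1) * t' ^ a * v ^ c), u ^ (a' + b' - 1) * t' ^ a' * v ^ c'] := by
  obtain ⟨k, hk⟩ := Nat.exists_eq_add_of_le hab
  obtain ⟨l, hl⟩ := Nat.exists_eq_add_of_le hab'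
  rw [hk, hl, Nat.add_sub_cancel_left, Nat.add_sub_cancel_left,
    show U * ((u * t') ^ a * u ^ b * v ^ c) = u * (U * (u ^ k * t' ^ a * v ^ c)) by
      rw [mul_pow, show U * (u ^ a * t' ^ a * u ^ b * v ^ c) = u ^ (a + b) * (U * (t' ^ a * v ^ c)) by ring, hk]; ring,
    show (u * t') ^ a' * u ^ b' * v ^ c' = u * (u ^ l * t' ^ a' * v ^ c') by
      rw [mul_pow, show u ^ a' * t' ^ a' * u ^ b' * v ^ c' = u ^ (a' + b') * (t' ^ a' * v ^ c') by ring, hl]; ring,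
    germ_factor]

/-- **Curve, `g`-chart** (`t = g t′`, `u = g u′`; `a + b ≥ 1`, `a′ + b′ ≥ 1`): the germ is `(g)`. [folklore] -/
theorem tail_curve_gchart (g U t' u' v : A) {a b : ℕ} (c : ℕ) {a' b' : ℕ} (c' : ℕ) (hab : 1 ≤ a + b) (hab' : 1 ≤ a' + b') :
    Kl[g, U * ((g * t') ^ a * (g * u') ^ b * v ^ c), (g * t') ^ a' * (g * u') ^ b' * v ^ c'] = Ideal.span {g} := by
  obtain ⟨k, hk⟩ := Nat.exists_eq_add_of_le hab
  obtain ⟨l, hl⟩ := Nat.exists_eq_add_of_le hab'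
  rw [show U * ((g * t') ^ a * (g * u') ^ b * v ^ c) = g * (U * g ^ k * t' ^ a * u' ^ b * v ^ c) by
      rw [mul_pow, mul_pow, show U * (g ^ a * t' ^ a * (g ^ b * u' ^ b) * v ^ c) = g ^ (a + b) * (U * t' ^ a * u' ^ b * v ^ c) by ring,
        hk]; ring,
    show (g * t') ^ a' * (g * u') ^ b' * v ^ c' = g * (g ^ l * t' ^ a' * u' ^ b' * v ^ c') by
      rw [mul_pow, mul_pow, show g ^ a' * t' ^ a' * (g ^ b' * u' ^ b') * v ^ c' = g ^ (a' + b') * (t' ^ a' * u' ^ b' * v ^ c') by ring,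
        hl]; ring,
    germ_eq_span_of_dvd]

/-- **Point** (centre `V(g, t, u, v)`; `a + b + c ≥ 1`, `a′ + b′ + c′ ≥ 1`), `t`-chart (`g = t g′`, `u = t u′`, `v = t v′`): the new
exceptional `t` carries `a + b + c − 1` resp. `a′ + b′ + c′ − 1`; `u′`, `v′` keep their exponents (the `u`-, `v`-charts by symmetry).
[folklore] -/
theorem tail_point_chart (g' U t u' v' : A) {a b c a' b' c' : ℕ} (h : 1 ≤ a + b + c) (h' : 1 ≤ a' + b' + c') :
    Kl[t * g', U * (t ^ a * (t * u') ^ b * (t * v') ^ c), t ^ a' * (t * u') ^ b' * (t * v') ^ c'] =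
      Ideal.span {t} * Kl[g', U * (t ^ (a + b + c - 1) * u' ^ b * v' ^ c), t ^ (a' + b' + c' - 1) * u' ^ b' * v' ^ c'] := by
  obtain ⟨k, hk⟩ := Nat.exists_eq_add_of_le h
  obtain ⟨l, hl⟩ := Nat.exists_eq_add_of_le h'
  rw [hk, hl, Nat.add_sub_cancel_left, Nat.add_sub_cancel_left,
    show U * (t ^ a * (t * u') ^ b * (t * v') ^ c) = t * (U * (t ^ k * u' ^ b * v' ^ c)) by
      rw [mul_pow, mul_pow, show U * (t ^ a * (t ^ b * u' ^ b) * (t ^ c * v' ^ c)) = t ^ (a + b + c) * (U * (u' ^ b * v' ^ c)) by ring,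
        hk]; ring,
    show t ^ a' * (t * u') ^ b' * (t * v') ^ c' = t * (t ^ l * u' ^ b' * v' ^ c') by
      rw [mul_pow, mul_pow, show t ^ a' * (t ^ b' * u' ^ b') * (t ^ c' * v' ^ c') = t ^ (a' + b' + c') * (u' ^ b' * v' ^ c') by ring,
        hl]; ring,
    germ_factor]

/-- **Point, `g`-chart** (`t = g t′`, `u = g u′`, `v = g v′`): the germ is `(g)`. [folklore] -/
theorem tail_point_gchart (g U t' u' v' : A) {a b c a' b' c' : ℕ} (h : 1 ≤ a + b + c) (h' : 1 ≤ a' + b' + c') :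
    Kl[g, U * ((g * t') ^ a * (g * u') ^ b * (g * v') ^ c), (g * t') ^ a' * (g * u') ^ b' * (g * v') ^ c'] = Ideal.span {g} := by
  obtain ⟨k, hk⟩ := Nat.exists_eq_add_of_le h
  obtain ⟨l, hl⟩ := Nat.exists_eq_add_of_le h'
  rw [show U * ((g * t') ^ a * (g * u') ^ b * (g * v') ^ c) = g * (U * g ^ k * t' ^ a * u' ^ b * v' ^ c) by
      rw [mul_pow, mul_pow, mul_pow, show U * (g ^ a * t' ^ a * (g ^ b * u' ^ b) * (g ^ c * v' ^ c)) =
        g ^ (a + b + c) * (U * t' ^ a * u' ^ b * v' ^ c) by ring, hk]; ring,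
    show (g * t') ^ a' * (g * u') ^ b' * (g * v') ^ c' = g * (g ^ l * t' ^ a' * u' ^ b' * v' ^ c') by
      rw [mul_pow, mul_pow, mul_pow, show g ^ a' * t' ^ a' * (g ^ b' * u' ^ b') * (g ^ c' * v' ^ c') =
        g ^ (a' + b' + c') * (t' ^ a' * u' ^ b' * v' ^ c') by ring, hl]; ring,
    germ_eq_span_of_dvd]

end Three

/-! ## §2 The general law: `k` member letters, any centre `I ∋ j` -/

section General

variable {A : Type u} [CommRing A] {k : ℕ}

/-- **The chart substitution on a monomial**: on the `t_j`-chart of the blow-up of the stratum `V(t_I)` (`j ∈ I`), substituting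
`tᵢ = s_j sᵢ` for `i ∈ I ∖ {j}` and `tᵢ = sᵢ` otherwise turns `∏ tᵢ^{aᵢ}` into `s_j^{Σ_{i ∈ I} aᵢ} · ∏_{i ≠ j} sᵢ^{aᵢ}`. [folklore] -/
theorem prod_pow_chartSubst [DecidableEq (Fin k)] (I : Finset (Fin k)) {j : Fin k} (hj : j ∈ I) (s : Fin k → A) (a : Fin k → ℕ) :
    ∏ i, (if i ∈ I ∧ i ≠ j then s j * s i else s i) ^ a i =
      s j ^ (∑ i ∈ I, a i) * ∏ i ∈ Finset.univ.erase j, s i ^ a i := by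
  classical
  have h1 : ∀ i, (if i ∈ I ∧ i ≠ j then s j * s i else s i) ^ a i =
      (if i ∈ I ∧ i ≠ j then s j ^ a i else 1) * s i ^ a i := by
    intro i
    split_ifs
    · rw [mul_pow]
    · rw [one_mul]
  simp_rw [h1]
  rw [Finset.prod_mul_distrib, ← Finset.prod_filter, Finset.prod_pow_eq_pow_sum,
    ← Finset.mul_prod_erase Finset.univ (fun i => s i ^ a i) (Finset.mem_univ j)]
  have hfilter : Finset.univ.filter (fun i => i ∈ I ∧ i ≠ j) = I.erase j := by
    ext i
    simp only [Finset.mem_filter, Finset.mem_univ, true_and, Finset.mem_erase]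
    exact and_comm
  rw [hfilter, ← mul_assoc, ← pow_add, Finset.sum_erase_add _ _ hj]

/-- **The `g`-chart substitution on a monomial** (`tᵢ = g sᵢ` for `i ∈ I`): `∏ tᵢ^{aᵢ} = g^{Σ_{i ∈ I} aᵢ} · ∏ sᵢ^{aᵢ}`. [folklore] -/
theorem prod_pow_gSubst [DecidableEq (Fin k)] (I : Finset (Fin k)) (g : A) (s : Fin k → A) (a : Fin k → ℕ) :
    ∏ i, (if i ∈ I then g * s i else s i) ^ a i = g ^ (∑ i ∈ I, a i) * ∏ i, s i ^ a i := by
  classical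
  have h1 : ∀ i, (if i ∈ I then g * s i else s i) ^ a i = (if i ∈ I then g ^ a i else 1) * s i ^ a i := by
    intro i
    split_ifs
    · rw [mul_pow]
    · rw [one_mul]
  simp_rw [h1]
  rw [Finset.prod_mul_distrib, ← Finset.prod_filter, Finset.prod_pow_eq_pow_sum]
  have hfilter : Finset.univ.filter (fun i => i ∈ I) = I := by
    ext i
    simp only [Finset.mem_filter, Finset.mem_univ, true_and]
  rw [hfilter]

/-- [OURS · L1 W5.2 · X3 C-II] **THE GENERAL TAIL LAW** (`k` member letters, centre the stratum `V(g, t_I)`, chart `t_j`, `j ∈ I`, legal for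
`|α_I(M)|, |α_I(N̄)| ≥ 1`): `K = (s_j) · ((g′) + (g′ + U · s_j^{|α_I(a)| − 1} ∏_{i≠j} sᵢ^{aᵢ}) + (s_j^{|α_I(b)| − 1} ∏_{i≠j} sᵢ^{bᵢ}))` — the new
exceptional letter `s_j` carries `|α_I| − 1`, every other exponent is kept, `U` is unchanged. [cite: Kollar2007, (3.111) Step 3] -/
theorem tail_chart_general [DecidableEq (Fin k)] (I : Finset (Fin k)) {j : Fin k} (hj : j ∈ I) (g' U : A) (s : Fin k → A)
    (a b : Fin k → ℕ) (ha : 1 ≤ ∑ i ∈ I, a i) (hb : 1 ≤ ∑ i ∈ I, b i) :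
    Kl[s j * g', U * ∏ i, (if i ∈ I ∧ i ≠ j then s j * s i else s i) ^ a i,
        ∏ i, (if i ∈ I ∧ i ≠ j then s j * s i else s i) ^ b i] =
      Ideal.span {s j} * Kl[g', U * (s j ^ (∑ i ∈ I, a i - 1) * ∏ i ∈ Finset.univ.erase j, s i ^ a i),
        s j ^ (∑ i ∈ I, b i - 1) * ∏ i ∈ Finset.univ.erase j, s i ^ b i] := by
  have hsa : s j ^ (∑ i ∈ I, a i) = s j * s j ^ (∑ i ∈ I, a i - 1) := by
    rw [← pow_succ', Nat.sub_add_cancel ha]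
  have hsb : s j ^ (∑ i ∈ I, b i) = s j * s j ^ (∑ i ∈ I, b i - 1) := by
    rw [← pow_succ', Nat.sub_add_cancel hb]
  rw [prod_pow_chartSubst I hj s a, prod_pow_chartSubst I hj s b, hsa, hsb,
    show U * (s j * s j ^ (∑ i ∈ I, a i - 1) * ∏ i ∈ Finset.univ.erase j, s i ^ a i) =
      s j * (U * (s j ^ (∑ i ∈ I, a i - 1) * ∏ i ∈ Finset.univ.erase j, s i ^ a i)) by ring,
    show s j * s j ^ (∑ i ∈ I, b i - 1) * ∏ i ∈ Finset.univ.erase j, s i ^ b i =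
      s j * (s j ^ (∑ i ∈ I, b i - 1) * ∏ i ∈ Finset.univ.erase j, s i ^ b i) by ring,
    germ_factor]

/-- **The general `g`-chart**: the germ is `(g)` (for `|α_I(M)|, |α_I(N̄)| ≥ 1`). [folklore] -/
theorem tail_gchart_general [DecidableEq (Fin k)] (I : Finset (Fin k)) (g U : A) (s : Fin k → A) (a b : Fin k → ℕ)
    (ha : 1 ≤ ∑ i ∈ I, a i) (hb : 1 ≤ ∑ i ∈ I, b i) :
    Kl[g, U * ∏ i, (if i ∈ I then g * s i else s i) ^ a i, ∏ i, (if i ∈ I then g * s i else s i) ^ b i] = Ideal.span {g} := by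
  have hga : g ^ (∑ i ∈ I, a i) = g * g ^ (∑ i ∈ I, a i - 1) := by
    rw [← pow_succ', Nat.sub_add_cancel ha]
  have hgb : g ^ (∑ i ∈ I, b i) = g * g ^ (∑ i ∈ I, b i - 1) := by
    rw [← pow_succ', Nat.sub_add_cancel hb]
  rw [prod_pow_gSubst I g s a, prod_pow_gSubst I g s b, hga, hgb,
    show U * (g * g ^ (∑ i ∈ I, a i - 1) * ∏ i, s i ^ a i) = g * (U * g ^ (∑ i ∈ I, a i - 1) * ∏ i, s i ^ a i) by ring,
    show g * g ^ (∑ i ∈ I, b i - 1) * ∏ i, s i ^ b i = g * (g ^ (∑ i ∈ I, b i - 1) * ∏ i, s i ^ b i) by ring,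
    germ_eq_span_of_dvd]

end General

/-! ## §3 END leaves -/

section End

variable {A : Type u} [CommRing A]

/-- **WEAK END holds at every point of the class**: `K = (g) + (M) + (N̄)` as ideals (a monomial sum in the carrier host and the members).
[folklore] -/
theorem tail_weak (g M n : A) {U : A} (hU : IsUnit U) : Kl[g, U * M, n] = Ideal.span {g} ⊔ Ideal.span {M} ⊔ Ideal.span {n} := by
  rw [germ_eq, Ideal.span_singleton_mul_left_unit hU]

/-- **Leaving the cosupport**: where `M` is a unit the germ is the unit ideal. [folklore] -/
theorem tail_eq_top_of_isUnit (g n : A) {U M : A} (hU : IsUnit U) (hM : IsUnit M) : Kl[g, U * M, n] = ⊤ := by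
  rw [tail_weak g M n hU, Ideal.span_singleton_eq_top.mpr hM, sup_top_eq, top_sup_eq]

/-- **RESIDUAL-EMPTY leaf, left** (RULING G11-25 A8: `K = M_common · K♭`, target «`K♭` a unit at the point»): if `M ∣ N̄` then
`K = (g) + (M)` — on the carrier `K̄ = (M)` is ONE principal monomial, its residual `K̄♭` is the unit ideal.  (Strict END needs `M` itself
to be a unit; the gap «`M ∣ N̄` or `N̄ ∣ M` but `M ≠ 1`» is the local-principalization tail.) [folklore] -/
theorem tail_of_dvd_left (g n : A) {U M : A} (hU : IsUnit U) (h : M ∣ n) : Kl[g, U * M, n] = Ideal.span {g} ⊔ Ideal.span {M} := by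
  rw [tail_weak g M n hU]
  exact sup_eq_left.mpr (le_sup_of_le_right (Ideal.span_singleton_le_span_singleton.mpr h))

/-- **RESIDUAL-EMPTY leaf, right**: if `N̄ ∣ M` then `K = (g) + (N̄)` (`K̄ = (N̄)` principal, `K̄♭ = ⊤`). [folklore] -/
theorem tail_of_dvd_right (g n : A) {U M : A} (hU : IsUnit U) (h : n ∣ M) : Kl[g, U * M, n] = Ideal.span {g} ⊔ Ideal.span {n} := by
  rw [tail_weak g M n hU, sup_assoc]
  congr 1
  exact sup_eq_right.mpr (Ideal.span_singleton_le_span_singleton.mpr h)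

/-- **STRICT non-END**: if a member letter `t` through the point divides `M`, then `(g, g + U·M, t)` is NOT part of a regular system of
parameters — the second host lies in the ideal `(g, t)` of the other two (minimality, Matsumura 14.2).  By `IsRsopPart.comp`, no
format family containing these three is.  So in the pure-member tail class STRICT END at a point of `cosupp K` holds iff NO member through
the point divides `M`. [cite: Matsumura1987, Thm. 14.2] -/
theorem tail_not_isRsopPart [IsLocalRing A] (g U t M₁ : A) : ¬ IsRsopPart ![g, g + U * (t * M₁), t] := by
  intro hz
  have hg : g ∈ Ideal.span ((![g, g + U * (t * M₁), t] : Fin 3 → A) '' {0, 2}) :=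
    Ideal.subset_span ⟨0, by simp, rfl⟩
  have ht : t ∈ Ideal.span ((![g, g + U * (t * M₁), t] : Fin 3 → A) '' {0, 2}) :=
    Ideal.subset_span ⟨2, by simp, rfl⟩
  have hmem : (![g, g + U * (t * M₁), t] : Fin 3 → A) 1 ∈ Ideal.span ((![g, g + U * (t * M₁), t] : Fin 3 → A) '' {0, 2}) := by
    show g + U * (t * M₁) ∈ _
    exact Ideal.add_mem _ hg (Ideal.mul_mem_left _ U (Ideal.mul_mem_right M₁ _ ht))
  exact hz.not_mem_span_image (S := {0, 2}) (i := 1) (by simp) hmem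

/-- The same with the member letter as the FIRST host of the test family: `(t, g, g + U·M)` with `t ∣ M` is not part of a regular system
of parameters. [folklore] -/
theorem tail_not_isRsopPart' [IsLocalRing A] (g U t M₁ : A) : ¬ IsRsopPart ![t, g, g + U * (t * M₁)] := by
  intro hz
  have h := hz.comp (![1, 2, 0] : Fin 3 → Fin 3) (by decide)
  have he : (![t, g, g + U * (t * M₁)] : Fin 3 → A) ∘ (![1, 2, 0] : Fin 3 → Fin 3) = ![g, g + U * (t * M₁), t] := by
    funext i
    fin_cases i <;> rfl
  rw [he] at h
  exact tail_not_isRsopPart g U t M₁ h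

end End

end DepthPhaseC

end Summit.ResolutionOfSingularities.ResolutionOfSingularities.Theorems

end
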